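import Literature.Analysis.Asymptotics.LinearRecurrencePolynomialSource
import Literature.Probability.RandomPlanarGeometry.HexSAWStripWidthThreeHatContactAnnihilator
import HarnessLib

/-!
# The width-three strip at criticality: the contact hat sums `Ĉ(k)` grow LINEARLY and the squared-contact sums `Ĉ²(k)` QUADRATICALLY,
# with geometric errors and the leading coefficients FORCED — `Ĉ(k)_{ab} ≈ c·A_{ab}·k`, `Ĉ²(k)_{ab} ≈ c²·A_{ab}·k²`, `c = −T_y/T_λ`
# (module «WIDTH-THREE CONTACT ASYMPTOTICS»)

Topic `Literature/Probability/RandomPlanarGeometry` (continues «WIDTH-THREE HAT CONTACT ANNIHILATOR» — `W3.detY_contact_annihilator`, `W3.detY_contact_sq_annihilator`,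
`W3.detY`, `W3.detYDot`, `W3.detYDDot` —, «WIDTH-THREE HAT ANNIHILATOR» #1457 — ★★★★ `W3.hatD_three_geometric` —, «WIDTH-THREE HAT CONVERGENCE CRITERION» — `W3.qMonicThree`
(monic, degree `23`, roots in `‖z‖ ≤ 0.97`), `W3.tauPolyThree_eq` (`τ = b₁₀(X − 1)Q`), `W3.sum_coeff_X_sub_one_mul` —, «LENGTH-POINTWISE-LAW» — `HV.exists_tendsto_LUM_parity`
(the hat bridge sums converge to a POSITIVE rank-one limit) — and the model-free «LINEAR RECURRENCE WITH POLYNOMIAL SOURCE» —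
`Literature.Analysis.exists_abs_sub_quadratic_le_of_linearRecurrence_one_real`).  Lane «pcv-sawmu» (CriticalPhenomena venture), a-p2 g29 — step 3 of the width-three
contact-VARIANCE programme.  Setting: W. Feller I (1968) XIII.6 (`E N_k = k/μ + O(1)`, second moment of the number of renewals); R. P. Stanley EC1 (2012) §4.1.
The strip is a six-type matrix renewal whose kernel is NOT finitely supported; nothing below is printed.

## What is proved (namespace `…SAW.HV.W3`; `y₃ = stripYT 3`, `R = 97/100`)

* §1 `limDThree` (`A`, the limit of the hat bridge sums, from #1457), `abs_hatD_three_sub_lim_le`, `tendsto_hatD_three_succ`, ★ `limDThree_pos` (`A_{ab} > 0`, by the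
  pointwise law in length).
* §2 The five scalars of `T(λ, y) = det P = Σ_r t_r(y)λ^r` at `(1, y₃)`: `tOneThree = Σ r t_r` (`T_λ`), `tTwoThree = Σ r(r−1) t_r` (`T_λλ`), `tyThree = Σ ṫ_r` (`yT_y`),
  `tlyThree = Σ r ṫ_r` (`yT_λy`), `tyyThree = Σ ẗ_r` (`(y∂_y)²T`); `cThree = −tyThree/tOneThree` (`= y₃λ′(y₃)`, the hat-index growth of the Perron root: numerically
  `0.6607415407 = 2θ₃`); ★ `X_sub_one_mul_qMonicThree_coeff` (`((X−1)Q)_r = t_r(y₃)`), `sum_coeff_qMonicThree` (`Σ_j Q_j = T_λ`), `sum_coeff_mul_qMonicThree`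
  (`Σ_j jQ_j = T_λλ/2`).
* §3 Plumbing: `succ_add_pow_mul_pow_le`, `abs_sum_mul_shift_le`.
* §4 ★★★ **`exists_hatCD_three_linear`**: `T_λ ≠ 0` and `∃ m₀ K, |Ĉ(n+1)_{ab} − (c·A_{ab}·n + m₀)| ≤ K(n+1)^{46}Rⁿ` — the mean number of surface contacts of a
  critical `S₃` bridge is LINEAR in the hat index with slope `c` per hat index (`= 2θ₃`, two steps per hat index), up to `O(1)`.
* §5 ★★★ **`exists_hatC2D_three_quadratic`**: with the same `m₀`, `∃ m₂ K, |Ĉ²(n+1)_{ab} − (c²A_{ab}·n² + linQThree A_{ab} m₀·n + m₂)| ≤ K(n+1)^{69}Rⁿ` with the explicit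
  linear coefficient `linQThree A m₀ = (−2cA·T_λy − 2m₀·T_y − T_yy·A − c²A·T_λλ)/T_λ − c²A` — the second moment, to the order that decides the variance.

Label: LANE THEOREM (own result of lane «pcv-sawmu», a-p2 g29, 2026-08-28; not in print).  NOT claimed: the variance law itself and the value of `σ₃²` (next module
«WIDTH-THREE CONTACT VARIANCE»), closed forms of `m₀`, `m₂`, the identification `c = 2θ₃` with «WIDTH-THREE-DENSITY».
-/

noncomputable section

open Finset Filter Topology Matrix Polynomial Literature.Probability.LatticeModels Literature.Probability.Percolation

namespace Literature.Probability.RandomPlanarGeometry.SAW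

namespace HV

namespace W3

/-! ## §1 The limit of the hat bridge sums and its positivity -/

/-- `A = lim_k D̂(k)` at `y₃` — the limit matrix of «WIDTH-THREE HAT ANNIHILATOR»'s `hatD_three_geometric` (chosen once and for all).
[cite: Stanley2012EC1, §4.1 Theorem 4.1.1 (iii); Feller1968, XIII.3; lane «pcv-sawmu» a-p2 g28/g29] -/
def limDThree : Matrix (Fin (2 * 3)) (Fin (2 * 3)) ℝ := Classical.choose hatD_three_geometric

/-- `|D̂(n+1)_{ab} − A_{ab}| ≤ K(n+1)^{23}(0.97)ⁿ` (restatement of `hatD_three_geometric` for the chosen `A`). [cite: Stanley2012EC1, §4.1 Theorem 4.1.1 (iii); lane «pcv-sawmu» a-p2 g28] -/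
theorem abs_hatD_three_sub_lim_le : ∃ K : ℝ, ∀ (a b : Fin (2 * 3)) (n : ℕ),
    |hatD 3 (stripYT 3) (n + 1) a b - limDThree a b| ≤ K * ((n : ℝ) + 1) ^ 23 * (97 / 100 : ℝ) ^ n :=
  Classical.choose_spec hatD_three_geometric

/-- `D̂(n+1)_{ab} → A_{ab}` (plumbing). [cite: Feller1968, XIII.3; lane plumbing] -/
theorem tendsto_hatD_three_succ (a b : Fin (2 * 3)) : Tendsto (fun n : ℕ => hatD 3 (stripYT 3) (n + 1) a b) atTop (𝓝 (limDThree a b)) := by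
  obtain ⟨K, hK⟩ := abs_hatD_three_sub_lim_le
  have h := Literature.Analysis.tendsto_succ_pow_mul_of_abs_le (e := fun n => hatD 3 (stripYT 3) (n + 1) a b - limDThree a b)
    (by norm_num : (0 : ℝ) < 97 / 100) (by norm_num) (fun n => hK a b n) 0
  simp only [pow_zero, one_mul] at h
  have := h.add_const (limDThree a b)
  simpa using this

/-- ★ **`A_{ab} > 0`** for all levels: the limit of the hat bridge sums is the positive rank-one matrix `2ρ′u′_aℓ′_b` of «LENGTH-POINTWISE-LAW».
[cite: Feller1968, XIII.3, XIII.11 (renewal theorem); lane «pcv-sawmu» a-p2 g21/g29] -/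
theorem limDThree_pos (a b : Fin (2 * 3)) : 0 < limDThree a b := by
  obtain ⟨u, ℓ, ρ, hu, hℓ, hρ, -, hlim⟩ := exists_tendsto_LUM_parity (T := 3) (by norm_num)
  have h1 : Tendsto (fun k : ℕ => hatD 3 (stripYT 3) k a b) atTop (𝓝 (2 * (ρ * (u a * ℓ b)))) := by
    have h := hlim a b
    unfold hatD hatLen
    exact h
  have h2 : Tendsto (fun n : ℕ => hatD 3 (stripYT 3) (n + 1) a b) atTop (𝓝 (2 * (ρ * (u a * ℓ b)))) :=
    (tendsto_add_atTop_iff_nat (f := fun k : ℕ => hatD 3 (stripYT 3) k a b) 1).2 h1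
  have hpos : 0 < 2 * (ρ * (u a * ℓ b)) := mul_pos two_pos (mul_pos hρ (mul_pos (hu a) (hℓ b)))
  have heq : limDThree a b = 2 * (ρ * (u a * ℓ b)) := tendsto_nhds_unique (tendsto_hatD_three_succ a b) h2
  rw [heq]
  exact hpos

/-! ## §2 The five scalars of `det P` at `(1, y₃)` and the coefficient data of `Q` -/

/-- `T_λ := Σ_r r·t_r(y₃)` (`= ∂_λ det P(1; y₃)`; numerically `0.45976`). [cite: Stanley2012EC1, §4.1 Theorem 4.1.1; lane «pcv-sawmu» a-p2 g29] -/
def tOneThree : ℝ := ∑ r ∈ range 25, (r : ℝ) * detY (stripYT 3) r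

/-- `T_λλ := Σ_r r(r−1)·t_r(y₃)` (numerically `22.5368`). [cite: Stanley2012EC1, §4.1 Theorem 4.1.1; lane «pcv-sawmu» a-p2 g29] -/
def tTwoThree : ℝ := ∑ r ∈ range 25, (r : ℝ) * ((r : ℝ) - 1) * detY (stripYT 3) r

/-- `T_y := Σ_r ṫ_r(y₃)` (`= y∂_y det P(1; y)` at `y₃`; numerically `−0.303782`). [cite: Feller1968, XIII.6; lane «pcv-sawmu» a-p2 g29] -/
def tyThree : ℝ := ∑ r ∈ range 25, detYDot (stripYT 3) r

/-- `T_λy := Σ_r r·ṫ_r(y₃)` (numerically `−7.77245`). [cite: Feller1968, XIII.6; lane «pcv-sawmu» a-p2 g29] -/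
def tlyThree : ℝ := ∑ r ∈ range 25, (r : ℝ) * detYDot (stripYT 3) r

/-- `T_yy := Σ_r ẗ_r(y₃)` (`= (y∂_y)² det P(1; y)` at `y₃`; numerically `−0.0221540`). [cite: Feller1968, XIII.6; lane «pcv-sawmu» a-p2 g29] -/
def tyyThree : ℝ := ∑ r ∈ range 25, detYDDot (stripYT 3) r

/-- `c := −T_y/T_λ` — the logarithmic `y`-derivative `y₃λ′(y₃)` of the Perron root per hat index (implicit differentiation of `det P(λ(y); y) = 0`);
numerically `0.6607415407 = 2θ₃`. [cite: Feller1968, XIII.6 (`E N_k ∼ k/μ`); lane «pcv-sawmu» a-p2 g29] -/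
def cThree : ℝ := -tyThree / tOneThree

/-- The linear coefficient of `Ĉ²(n+1)_{ab}` in terms of `A = A_{ab}` and the intercept `m₀` of `Ĉ`:
`(−2cA·T_λy − 2m₀T_y − T_yy·A − c²A·T_λλ)/T_λ − c²A`. [cite: Feller1968, XIII.6; lane «pcv-sawmu» a-p2 g29] -/
def linQThree (A m₀ : ℝ) : ℝ :=
  (-2 * cThree * A * tlyThree - 2 * m₀ * tyThree - tyyThree * A - cThree ^ 2 * A * tTwoThree) / tOneThree - cThree ^ 2 * A

/-- ★ The coefficients of `(X − 1)·Q` are the `t_r(y₃)`: `((X − 1)Q)_r = detY y₃ r` (`r < 25`; from `τ = b₁₀(X−1)Q`, `τ_r = b₁₀t_r`, `t_r = detY`).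
[cite: Stanley2012EC1, §4.1 Theorem 4.1.1; lane «pcv-sawmu» a-p2 g28/g29] -/
theorem X_sub_one_mul_qMonicThree_coeff (r : ℕ) (hr : r < 25) :
    ((X - C 1) * qMonicThree).coeff r = ((detY (stripYT 3) r : ℝ) : ℂ) := by
  have hb : ((bTenThree : ℝ) : ℂ) ≠ 0 := by exact_mod_cast bTenThree_neg.ne
  have h1 : tauPolyThree.coeff r = ((bTenThree : ℝ) : ℂ) * ((X - C 1) * qMonicThree).coeff r := by rw [tauPolyThree_eq, coeff_C_mul]
  have h2 := tauPolyThree_coeff r hr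
  have h3 := tauThree_link (stripYT 3) r hr
  rw [tDetThree_xc_eq_detY _ r hr] at h3
  apply mul_left_cancel₀ hb
  rw [← h1, h2, h3]
  push_cast
  ring

/-- `Σ_{j ≤ 23} Q_j = T_λ` (`= Q(1) = ((X−1)Q)′(1)`; bookkeeping with `d_m = m`). [cite: Stanley2012EC1, §4.1 Theorem 4.1.1; lane plumbing] -/
theorem sum_coeff_qMonicThree : ∑ j ∈ range (qMonicThree.natDegree + 1), qMonicThree.coeff j = ((tOneThree : ℝ) : ℂ) := by
  obtain ⟨_, hdeg⟩ := qMonicThree_monic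
  rw [hdeg]
  have h := sum_coeff_X_sub_one_mul qMonicThree hdeg (fun m => (m : ℂ)) 0
  have lhs : ∑ j ∈ range 24, qMonicThree.coeff j * ((fun m : ℕ => (m : ℂ)) (0 + 1 + j))
      - ∑ j ∈ range 24, qMonicThree.coeff j * ((fun m : ℕ => (m : ℂ)) (0 + j)) = ∑ j ∈ range 24, qMonicThree.coeff j := by
    rw [← Finset.sum_sub_distrib]
    refine Finset.sum_congr rfl fun j _ => ?_
    push_cast; ring
  have rhs : ∑ r ∈ range 25, ((X - C 1) * qMonicThree).coeff r * ((fun m : ℕ => (m : ℂ)) (0 + r)) = ((tOneThree : ℝ) : ℂ) := by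
    unfold tOneThree
    rw [Complex.ofReal_sum]
    refine Finset.sum_congr rfl fun r hr => ?_
    rw [X_sub_one_mul_qMonicThree_coeff r (Finset.mem_range.1 hr)]
    push_cast; ring
  exact lhs.symm.trans (h.trans rhs)

/-- `Σ_{j ≤ 23} j·Q_j = T_λλ/2` (`= Q′(1) = ((X−1)Q)″(1)/2`; bookkeeping with `d_m = m(m−1)`). [cite: Stanley2012EC1, §4.1 Theorem 4.1.1; lane plumbing] -/
theorem sum_coeff_mul_qMonicThree :
    ∑ j ∈ range (qMonicThree.natDegree + 1), qMonicThree.coeff j * (j : ℂ) = ((tTwoThree / 2 : ℝ) : ℂ) := by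
  obtain ⟨_, hdeg⟩ := qMonicThree_monic
  rw [hdeg]
  have h := sum_coeff_X_sub_one_mul qMonicThree hdeg (fun m => (m : ℂ) * ((m : ℂ) - 1)) 0
  have lhs : ∑ j ∈ range 24, qMonicThree.coeff j * ((fun m : ℕ => (m : ℂ) * ((m : ℂ) - 1)) (0 + 1 + j))
      - ∑ j ∈ range 24, qMonicThree.coeff j * ((fun m : ℕ => (m : ℂ) * ((m : ℂ) - 1)) (0 + j))
      = 2 * ∑ j ∈ range 24, qMonicThree.coeff j * (j : ℂ) := by
    rw [← Finset.sum_sub_distrib, Finset.mul_sum]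
    refine Finset.sum_congr rfl fun j _ => ?_
    push_cast; ring
  have rhs : ∑ r ∈ range 25, ((X - C 1) * qMonicThree).coeff r * ((fun m : ℕ => (m : ℂ) * ((m : ℂ) - 1)) (0 + r))
      = ((tTwoThree : ℝ) : ℂ) := by
    unfold tTwoThree
    rw [Complex.ofReal_sum]
    refine Finset.sum_congr rfl fun r hr => ?_
    rw [X_sub_one_mul_qMonicThree_coeff r (Finset.mem_range.1 hr)]
    push_cast; ring
  have e : 2 * ∑ j ∈ range 24, qMonicThree.coeff j * (j : ℂ) = ((tTwoThree : ℝ) : ℂ) := lhs.symm.trans (h.trans rhs)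
  push_cast
  linear_combination e / 2

/-! ## §3 Plumbing: shifted geometric bounds and finite sums of errors -/

/-- `((n+r)+1)^k R^{n+r} ≤ (r+1)^k·(n+1)^k·Rⁿ` for `0 ≤ R ≤ 1` (plumbing). [cite: Stanley2012EC1, §4.1; lane plumbing] -/
theorem succ_add_pow_mul_pow_le {R : ℝ} (hR0 : 0 ≤ R) (hR1 : R ≤ 1) (n r k : ℕ) :
    (((n + r : ℕ) : ℝ) + 1) ^ k * R ^ (n + r) ≤ ((r : ℝ) + 1) ^ k * (((n : ℝ) + 1) ^ k * R ^ n) := by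
  have hn : (0 : ℝ) ≤ (n : ℝ) := Nat.cast_nonneg n
  have hr : (0 : ℝ) ≤ (r : ℝ) := Nat.cast_nonneg r
  have hle : ((n + r : ℕ) : ℝ) + 1 ≤ ((r : ℝ) + 1) * ((n : ℝ) + 1) := by rw [Nat.cast_add]; nlinarith [mul_nonneg hn hr]
  have hpow : (((n + r : ℕ) : ℝ) + 1) ^ k ≤ (((r : ℝ) + 1) * ((n : ℝ) + 1)) ^ k := pow_le_pow_left₀ (by positivity) hle k
  have hRle : R ^ (n + r) ≤ R ^ n := by rw [pow_add]; exact mul_le_of_le_one_right (pow_nonneg hR0 n) (pow_le_one₀ hR0 hR1)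
  calc (((n + r : ℕ) : ℝ) + 1) ^ k * R ^ (n + r) ≤ (((r : ℝ) + 1) * ((n : ℝ) + 1)) ^ k * R ^ n :=
        mul_le_mul hpow hRle (pow_nonneg hR0 _) (by positivity)
    _ = ((r : ℝ) + 1) ^ k * (((n : ℝ) + 1) ^ k * R ^ n) := by rw [mul_pow]; ring

/-- A finite sum of shifted errors: `|e_m| ≤ K(m+1)^kR^m` ⇒ `|Σ_{r<25} g_r e_{n+r}| ≤ (K Σ_r |g_r|(r+1)^k)·(n+1)^kRⁿ` (plumbing).
[cite: Stanley2012EC1, §4.1; lane plumbing] -/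
theorem abs_sum_mul_shift_le {g e : ℕ → ℝ} {K R : ℝ} {k : ℕ} (hR0 : 0 ≤ R) (hR1 : R ≤ 1) (hK : 0 ≤ K)
    (he : ∀ m : ℕ, |e m| ≤ K * ((m : ℝ) + 1) ^ k * R ^ m) (n : ℕ) :
    |∑ r ∈ range 25, g r * e (n + r)| ≤ (K * ∑ r ∈ range 25, |g r| * ((r : ℝ) + 1) ^ k) * (((n : ℝ) + 1) ^ k * R ^ n) := by
  calc |∑ r ∈ range 25, g r * e (n + r)| ≤ ∑ r ∈ range 25, |g r * e (n + r)| := Finset.abs_sum_le_sum_abs _ _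
    _ ≤ ∑ r ∈ range 25, |g r| * (K * ((r : ℝ) + 1) ^ k * (((n : ℝ) + 1) ^ k * R ^ n)) := by
        refine Finset.sum_le_sum fun r _ => ?_
        rw [abs_mul]
        refine mul_le_mul_of_nonneg_left ?_ (abs_nonneg _)
        calc |e (n + r)| ≤ K * (((n + r : ℕ) : ℝ) + 1) ^ k * R ^ (n + r) := he (n + r)
          _ = K * ((((n + r : ℕ) : ℝ) + 1) ^ k * R ^ (n + r)) := by ring
          _ ≤ K * (((r : ℝ) + 1) ^ k * (((n : ℝ) + 1) ^ k * R ^ n)) := mul_le_mul_of_nonneg_left (succ_add_pow_mul_pow_le hR0 hR1 n r k) hK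
          _ = K * ((r : ℝ) + 1) ^ k * (((n : ℝ) + 1) ^ k * R ^ n) := by ring
    _ = (K * ∑ r ∈ range 25, |g r| * ((r : ℝ) + 1) ^ k) * (((n : ℝ) + 1) ^ k * R ^ n) := by
        rw [Finset.mul_sum, Finset.sum_mul]; exact Finset.sum_congr rfl fun r _ => by ring

/-- The complex recurrence expression of `Q` on a real sequence equals the real `det P`-sum `Σ_r t_r·w_{n+r}` (plumbing: `sum_coeff_X_sub_one_mul` + §2).
[cite: Stanley2012EC1, §4.1 Theorem 4.1.1; lane plumbing] -/
theorem sum_coeff_qMonicThree_diff (w : ℕ → ℝ) (n : ℕ) :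
    ∑ j ∈ range (qMonicThree.natDegree + 1), qMonicThree.coeff j * (((w (n + 1 + j) : ℝ) : ℂ) - ((w (n + j) : ℝ) : ℂ))
      = ((∑ r ∈ range 25, detY (stripYT 3) r * w (n + r) : ℝ) : ℂ) := by
  obtain ⟨_, hdeg⟩ := qMonicThree_monic
  rw [hdeg]
  have h := sum_coeff_X_sub_one_mul qMonicThree hdeg (fun m => ((w m : ℝ) : ℂ)) n
  have lhs : ∑ j ∈ range 24, qMonicThree.coeff j * (((w (n + 1 + j) : ℝ) : ℂ) - ((w (n + j) : ℝ) : ℂ))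
      = ∑ j ∈ range 24, qMonicThree.coeff j * ((fun m : ℕ => ((w m : ℝ) : ℂ)) (n + 1 + j))
        - ∑ j ∈ range 24, qMonicThree.coeff j * ((fun m : ℕ => ((w m : ℝ) : ℂ)) (n + j)) := by
    rw [← Finset.sum_sub_distrib]; exact Finset.sum_congr rfl fun j _ => by ring
  have rhs : ∑ r ∈ range 25, ((X - C 1) * qMonicThree).coeff r * ((fun m : ℕ => ((w m : ℝ) : ℂ)) (n + r))
      = ((∑ r ∈ range 25, detY (stripYT 3) r * w (n + r) : ℝ) : ℂ) := by
    push_cast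
    refine Finset.sum_congr rfl fun r hr => ?_
    rw [X_sub_one_mul_qMonicThree_coeff r (Finset.mem_range.1 hr)]
  exact lhs.trans (h.trans rhs)

/-! ## §4 The first contact moment: LINEAR law with forced slope -/

/-- The constant `K₀` of #1457's bound is nonnegative (plumbing). [cite: Stanley2012EC1, §4.1; lane plumbing] -/
theorem nonneg_of_abs_hatD_bound {K₀ : ℝ} {a b : Fin (2 * 3)}
    (hK₀ : ∀ n : ℕ, |hatD 3 (stripYT 3) (n + 1) a b - limDThree a b| ≤ K₀ * ((n : ℝ) + 1) ^ 23 * (97 / 100 : ℝ) ^ n) : 0 ≤ K₀ := by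
  have h := hK₀ 0
  simp only [Nat.cast_zero, zero_add, one_pow, pow_zero, mul_one] at h
  exact (abs_nonneg _).trans h

/-- The source of the `Ĉ` recurrence: `Σ_r t_r Ĉ(n+r+1)_{ab} = −T_y·A_{ab} − Σ_r ṫ_r·(D̂(n+r+1)_{ab} − A_{ab})` (from `detY_contact_annihilator`).
[cite: Feller1968, XIII.6; lane «pcv-sawmu» a-p2 g29] -/
theorem hatCD_three_source (a b : Fin (2 * 3)) (n : ℕ) :
    ∑ r ∈ range 25, detY (stripYT 3) r * hatCD (stripYT 3) (n + r + 1) a b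
      = -(tyThree * limDThree a b) - ∑ r ∈ range 25, detYDot (stripYT 3) r * (hatD 3 (stripYT 3) (n + r + 1) a b - limDThree a b) := by
  have hy : 0 < stripYT 3 := by linarith [stripYT_three_bounds.1]
  have h := detY_contact_annihilator hy a b n
  have e1 : ∑ r ∈ range 25, detYDot (stripYT 3) r * (hatD 3 (stripYT 3) (n + r + 1) a b - limDThree a b)
      = ∑ r ∈ range 25, detYDot (stripYT 3) r * hatD 3 (stripYT 3) (n + 1 + r) a b - tyThree * limDThree a b := by
    rw [tyThree, Finset.sum_mul, ← Finset.sum_sub_distrib]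
    exact Finset.sum_congr rfl fun r _ => by rw [show n + r + 1 = n + 1 + r by ring]; ring
  have e2 : ∑ r ∈ range 25, detY (stripYT 3) r * hatCD (stripYT 3) (n + r + 1) a b
      = ∑ r ∈ range 25, detY (stripYT 3) r * hatCD (stripYT 3) (n + 1 + r) a b :=
    Finset.sum_congr rfl fun r _ => by rw [show n + r + 1 = n + 1 + r by ring]
  rw [e1, e2]; linarith

/-- The recurrence-with-source estimate for `Ĉ(n+1)_{ab}` in the form consumed by «LINEAR RECURRENCE WITH POLYNOMIAL SOURCE» (`ℓ₁ = 0`, `ℓ₀ = −T_yA_{ab}`).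
[cite: Feller1968, XIII.6; Stanley2012EC1, §4.1 Theorem 4.1.1 (iii); lane «pcv-sawmu» a-p2 g29] -/
theorem hatCD_three_recurrence_bound (a b : Fin (2 * 3)) : ∃ K : ℝ, 0 ≤ K ∧ ∀ n : ℕ,
    ‖∑ j ∈ range (qMonicThree.natDegree + 1), qMonicThree.coeff j
        * (((hatCD (stripYT 3) (n + 1 + j + 1) a b : ℝ) : ℂ) - ((hatCD (stripYT 3) (n + j + 1) a b : ℝ) : ℂ))
        - ((((0 : ℝ)) : ℂ) * (n : ℂ) + (((-(tyThree * limDThree a b)) : ℝ) : ℂ))‖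
      ≤ K * ((n : ℝ) + 1) ^ 23 * (97 / 100 : ℝ) ^ n := by
  obtain ⟨K₀, hK₀⟩ := abs_hatD_three_sub_lim_le
  have hK₀' : 0 ≤ K₀ := nonneg_of_abs_hatD_bound (hK₀ a b)
  refine ⟨K₀ * ∑ r ∈ range 25, |detYDot (stripYT 3) r| * ((r : ℝ) + 1) ^ 23,
    mul_nonneg hK₀' (Finset.sum_nonneg fun r _ => by positivity), fun n => ?_⟩
  rw [sum_coeff_qMonicThree_diff (fun m => hatCD (stripYT 3) (m + 1) a b) n, hatCD_three_source a b n]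
  have e : (((-(tyThree * limDThree a b)
        - ∑ r ∈ range 25, detYDot (stripYT 3) r * (hatD 3 (stripYT 3) (n + r + 1) a b - limDThree a b) : ℝ)) : ℂ)
        - ((((0 : ℝ)) : ℂ) * (n : ℂ) + (((-(tyThree * limDThree a b)) : ℝ) : ℂ))
      = -(((∑ r ∈ range 25, detYDot (stripYT 3) r * (hatD 3 (stripYT 3) (n + r + 1) a b - limDThree a b) : ℝ)) : ℂ) := by
    push_cast; ring
  rw [e, norm_neg, Complex.norm_real, Real.norm_eq_abs]
  have h := abs_sum_mul_shift_le (g := fun r => detYDot (stripYT 3) r) (e := fun m => hatD 3 (stripYT 3) (m + 1) a b - limDThree a b)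
    (by norm_num) (by norm_num) hK₀' (hK₀ a b) n
  simpa only [mul_assoc] using h

/-- ★★★ **The contact hat sums of the critical width-three strip grow linearly with forced slope.**  `T_λ ≠ 0`, and for all levels `a, b` there are
`m₀, K` with `|Ĉ(n+1)_{ab} − (c·A_{ab}·n + m₀)| ≤ K·(n+1)^{46}·(0.97)ⁿ` for all `n`, where `A = limDThree`, `c = cThree = −T_y/T_λ`.
Proof: by «CONTACT ANNIHILATOR» the sequence `Ĉ(n+1)_{ab}` satisfies the `(X−1)Q` recurrence with source `−Σ_r ṫ_r D̂(n+1+r)_{ab} → −T_y·A_{ab}` at rate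
`(n+1)^{23}(0.97)ⁿ` (#1457); «LINEAR RECURRENCE WITH POLYNOMIAL SOURCE» with `ℓ₁ = 0`, `ℓ₀ = −T_yA_{ab}`, `Q(1) = T_λ`.
[cite: Feller1968, XIII.6 (`E N_k = k/μ + O(1)`); Stanley2012EC1, §4.1 Theorem 4.1.1 (iii); lane «pcv-sawmu» a-p2 g29 — own result, not in print] -/
theorem exists_hatCD_three_linear (a b : Fin (2 * 3)) :
    tOneThree ≠ 0 ∧ ∃ m₀ K : ℝ, 0 ≤ K ∧ ∀ n : ℕ,
      |hatCD (stripYT 3) (n + 1) a b - (cThree * limDThree a b * (n : ℝ) + m₀)| ≤ K * ((n : ℝ) + 1) ^ 46 * (97 / 100 : ℝ) ^ n := by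
  obtain ⟨hQm, hdeg⟩ := qMonicThree_monic
  obtain ⟨K₁, hK₁, hw⟩ := hatCD_three_recurrence_bound a b
  obtain ⟨hT, m₀, K, hK, hb⟩ := Literature.Analysis.exists_abs_sub_quadratic_le_of_linearRecurrence_one_real
    (w := fun m => hatCD (stripYT 3) (m + 1) a b) (ℓ₁ := 0) (ℓ₀ := -(tyThree * limDThree a b)) hQm (by norm_num) (by norm_num)
    (fun z hz => qMonicThree_root_norm_le hz) sum_coeff_qMonicThree sum_coeff_mul_qMonicThree hK₁ hw
  refine ⟨hT, m₀, K, hK, fun n => ?_⟩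
  have h := hb n
  rw [hdeg] at h
  have e : (0 : ℝ) / tOneThree / 2 * (n : ℝ) ^ 2
      + ((-(tyThree * limDThree a b) - 0 / tOneThree * (tTwoThree / 2)) / tOneThree - 0 / tOneThree / 2) * (n : ℝ) + m₀
      = cThree * limDThree a b * (n : ℝ) + m₀ := by
    rw [cThree]; field_simp; ring
  rw [e] at h
  exact h

/-! ## §5 The second contact moment: QUADRATIC law with forced leading coefficient -/

/-- The source of the `Ĉ²` recurrence in terms of the errors of the lower moments: with `e₁(m) = Ĉ(m+1) − (cA·m + m₀)`, `e₀(m) = D̂(m+1) − A`,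
`Σ_r t_r Ĉ²(n+r+1) − (ℓ₁n + ℓ₀) = −(2Σ_r ṫ_r e₁(n+r) + Σ_r ẗ_r e₀(n+r))` where `ℓ₁ = −2cA·T_y`, `ℓ₀ = −2cA·T_λy − 2m₀T_y − T_yyA` (from
`detY_contact_sq_annihilator`). [cite: Feller1968, XIII.6; lane «pcv-sawmu» a-p2 g29] -/
theorem hatC2D_three_source (a b : Fin (2 * 3)) (m₀ : ℝ) (n : ℕ) :
    ∑ r ∈ range 25, detY (stripYT 3) r * hatC2D (stripYT 3) (n + r + 1) a b
        - (-2 * (cThree * limDThree a b) * tyThree * (n : ℝ)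
          + (-2 * (cThree * limDThree a b) * tlyThree - 2 * m₀ * tyThree - tyyThree * limDThree a b))
      = -(2 * ∑ r ∈ range 25, detYDot (stripYT 3) r * (hatCD (stripYT 3) (n + r + 1) a b - (cThree * limDThree a b * ((n + r : ℕ) : ℝ) + m₀))
          + ∑ r ∈ range 25, detYDDot (stripYT 3) r * (hatD 3 (stripYT 3) (n + r + 1) a b - limDThree a b)) := by
  have hy : 0 < stripYT 3 := by linarith [stripYT_three_bounds.1]
  have h := detY_contact_sq_annihilator hy a b n
  set A := limDThree a b with hA
  have e1 : ∑ r ∈ range 25, detYDot (stripYT 3) r * (hatCD (stripYT 3) (n + r + 1) a b - (cThree * A * ((n + r : ℕ) : ℝ) + m₀))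
      = ∑ r ∈ range 25, detYDot (stripYT 3) r * hatCD (stripYT 3) (n + 1 + r) a b
        - (cThree * A * (n : ℝ) * tyThree + cThree * A * tlyThree + m₀ * tyThree) := by
    rw [tyThree, tlyThree, Finset.mul_sum, Finset.mul_sum, Finset.mul_sum, ← Finset.sum_add_distrib, ← Finset.sum_add_distrib,
      ← Finset.sum_sub_distrib]
    exact Finset.sum_congr rfl fun r _ => by rw [show n + r + 1 = n + 1 + r by ring]; push_cast; ring
  have e2 : ∑ r ∈ range 25, detYDDot (stripYT 3) r * (hatD 3 (stripYT 3) (n + r + 1) a b - A)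
      = ∑ r ∈ range 25, detYDDot (stripYT 3) r * hatD 3 (stripYT 3) (n + 1 + r) a b - tyyThree * A := by
    rw [tyyThree, Finset.sum_mul, ← Finset.sum_sub_distrib]
    exact Finset.sum_congr rfl fun r _ => by rw [show n + r + 1 = n + 1 + r by ring]; ring
  have e3 : ∑ r ∈ range 25, detY (stripYT 3) r * hatC2D (stripYT 3) (n + r + 1) a b
      = ∑ r ∈ range 25, detY (stripYT 3) r * hatC2D (stripYT 3) (n + 1 + r) a b :=
    Finset.sum_congr rfl fun r _ => by rw [show n + r + 1 = n + 1 + r by ring]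
  rw [e1, e2, e3]; linarith

/-- The recurrence-with-source estimate for `Ĉ²(n+1)_{ab}` in the form consumed by «LINEAR RECURRENCE WITH POLYNOMIAL SOURCE».
[cite: Feller1968, XIII.6; Stanley2012EC1, §4.1 Theorem 4.1.1 (iii); lane «pcv-sawmu» a-p2 g29] -/
theorem hatC2D_three_recurrence_bound (a b : Fin (2 * 3)) {m₀ K₁ : ℝ} (hK₁ : 0 ≤ K₁)
    (hb₁ : ∀ n : ℕ, |hatCD (stripYT 3) (n + 1) a b - (cThree * limDThree a b * (n : ℝ) + m₀)| ≤ K₁ * ((n : ℝ) + 1) ^ 46 * (97 / 100 : ℝ) ^ n) :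
    ∃ K : ℝ, 0 ≤ K ∧ ∀ n : ℕ,
    ‖∑ j ∈ range (qMonicThree.natDegree + 1), qMonicThree.coeff j
        * (((hatC2D (stripYT 3) (n + 1 + j + 1) a b : ℝ) : ℂ) - ((hatC2D (stripYT 3) (n + j + 1) a b : ℝ) : ℂ))
        - ((((-2 * (cThree * limDThree a b) * tyThree : ℝ)) : ℂ) * (n : ℂ)
          + (((-2 * (cThree * limDThree a b) * tlyThree - 2 * m₀ * tyThree - tyyThree * limDThree a b : ℝ)) : ℂ))‖
      ≤ K * ((n : ℝ) + 1) ^ 46 * (97 / 100 : ℝ) ^ n := by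
  obtain ⟨K₀, hK₀⟩ := abs_hatD_three_sub_lim_le
  have hK₀' : 0 ≤ K₀ := nonneg_of_abs_hatD_bound (hK₀ a b)
  set S₁ : ℝ := K₁ * ∑ r ∈ range 25, |detYDot (stripYT 3) r| * ((r : ℝ) + 1) ^ 46 with hS₁
  set S₀ : ℝ := K₀ * ∑ r ∈ range 25, |detYDDot (stripYT 3) r| * ((r : ℝ) + 1) ^ 23 with hS₀
  have hS₁0 : 0 ≤ S₁ := mul_nonneg hK₁ (Finset.sum_nonneg fun r _ => by positivity)
  have hS₀0 : 0 ≤ S₀ := mul_nonneg hK₀' (Finset.sum_nonneg fun r _ => by positivity)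
  refine ⟨2 * S₁ + S₀, by linarith, fun n => ?_⟩
  rw [sum_coeff_qMonicThree_diff (fun m => hatC2D (stripYT 3) (m + 1) a b) n]
  rw [← Complex.ofReal_natCast, ← Complex.ofReal_mul, ← Complex.ofReal_add, ← Complex.ofReal_sub, Complex.norm_real, Real.norm_eq_abs,
    hatC2D_three_source a b m₀ n, abs_neg]
  have h1 := abs_sum_mul_shift_le (g := fun r => detYDot (stripYT 3) r)
    (e := fun m => hatCD (stripYT 3) (m + 1) a b - (cThree * limDThree a b * (m : ℝ) + m₀)) (by norm_num) (by norm_num) hK₁ hb₁ n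
  have h2 := abs_sum_mul_shift_le (g := fun r => detYDDot (stripYT 3) r) (e := fun m => hatD 3 (stripYT 3) (m + 1) a b - limDThree a b)
    (by norm_num) (by norm_num) hK₀' (hK₀ a b) n
  rw [← hS₁] at h1
  rw [← hS₀] at h2
  have hn1 : (1 : ℝ) ≤ (n : ℝ) + 1 := by linarith [(Nat.cast_nonneg n : (0 : ℝ) ≤ n)]
  have hpow : ((n : ℝ) + 1) ^ 23 * (97 / 100 : ℝ) ^ n ≤ ((n : ℝ) + 1) ^ 46 * (97 / 100 : ℝ) ^ n :=
    mul_le_mul_of_nonneg_right (pow_le_pow_right₀ hn1 (by norm_num)) (by positivity)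
  have h2' : |∑ r ∈ range 25, detYDDot (stripYT 3) r * (hatD 3 (stripYT 3) (n + r + 1) a b - limDThree a b)|
      ≤ S₀ * (((n : ℝ) + 1) ^ 46 * (97 / 100 : ℝ) ^ n) := h2.trans (mul_le_mul_of_nonneg_left hpow hS₀0)
  calc |2 * ∑ r ∈ range 25, detYDot (stripYT 3) r * (hatCD (stripYT 3) (n + r + 1) a b - (cThree * limDThree a b * ((n + r : ℕ) : ℝ) + m₀))
        + ∑ r ∈ range 25, detYDDot (stripYT 3) r * (hatD 3 (stripYT 3) (n + r + 1) a b - limDThree a b)|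
      ≤ |2 * ∑ r ∈ range 25, detYDot (stripYT 3) r * (hatCD (stripYT 3) (n + r + 1) a b - (cThree * limDThree a b * ((n + r : ℕ) : ℝ) + m₀))|
        + |∑ r ∈ range 25, detYDDot (stripYT 3) r * (hatD 3 (stripYT 3) (n + r + 1) a b - limDThree a b)| := abs_add_le _ _
    _ ≤ 2 * (S₁ * (((n : ℝ) + 1) ^ 46 * (97 / 100 : ℝ) ^ n)) + S₀ * (((n : ℝ) + 1) ^ 46 * (97 / 100 : ℝ) ^ n) := by
        rw [abs_mul, abs_two]
        exact add_le_add (mul_le_mul_of_nonneg_left h1 zero_le_two) h2'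
    _ = (2 * S₁ + S₀) * ((n : ℝ) + 1) ^ 46 * (97 / 100 : ℝ) ^ n := by ring

/-- ★★★ **The squared-contact hat sums grow quadratically with forced leading coefficient `c²A_{ab}`.**  For all levels `a, b` there are `m₀, m₂, K`
with `|Ĉ(n+1)_{ab} − (cA_{ab}·n + m₀)| ≤ K(n+1)^{46}(0.97)ⁿ` and `|Ĉ²(n+1)_{ab} − (c²A_{ab}·n² + linQThree A_{ab} m₀·n + m₂)| ≤ K(n+1)^{69}(0.97)ⁿ` for all `n`.
Proof: the `(X−1)Q` recurrence of `Ĉ²` has source `−2Σ_r ṫ_rĈ(n+1+r) − Σ_r ẗ_rD̂(n+1+r) = ℓ₁n + ℓ₀ + O((n+1)^{46}0.97ⁿ)` with `ℓ₁ = −2cA·T_y = 2c²A·T_λ`,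
`ℓ₀ = −2cA·T_λy − 2m₀T_y − T_yyA`; then «LINEAR RECURRENCE WITH POLYNOMIAL SOURCE», and `ℓ₁/(2T_λ) = c²A`.
[cite: Feller1968, XIII.6 (second moment of the number of renewals); Stanley2012EC1, §4.1 Theorem 4.1.1 (iii); lane «pcv-sawmu» a-p2 g29 — own result, not in print] -/
theorem exists_hatC2D_three_quadratic (a b : Fin (2 * 3)) :
    ∃ m₀ m₂ K : ℝ, (∀ n : ℕ,
      |hatCD (stripYT 3) (n + 1) a b - (cThree * limDThree a b * (n : ℝ) + m₀)| ≤ K * ((n : ℝ) + 1) ^ 46 * (97 / 100 : ℝ) ^ n) ∧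
      ∀ n : ℕ, |hatC2D (stripYT 3) (n + 1) a b - (cThree ^ 2 * limDThree a b * (n : ℝ) ^ 2 + linQThree (limDThree a b) m₀ * (n : ℝ) + m₂)|
        ≤ K * ((n : ℝ) + 1) ^ 69 * (97 / 100 : ℝ) ^ n := by
  obtain ⟨hQm, hdeg⟩ := qMonicThree_monic
  obtain ⟨hT, m₀, K₁, hK₁, hb₁⟩ := exists_hatCD_three_linear a b
  obtain ⟨K₂, hK₂, hw⟩ := hatC2D_three_recurrence_bound a b hK₁ hb₁
  obtain ⟨-, m₂, K₃, hK₃, hb₃⟩ := Literature.Analysis.exists_abs_sub_quadratic_le_of_linearRecurrence_one_real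
    (w := fun m => hatC2D (stripYT 3) (m + 1) a b) (ℓ₁ := -2 * (cThree * limDThree a b) * tyThree)
    (ℓ₀ := -2 * (cThree * limDThree a b) * tlyThree - 2 * m₀ * tyThree - tyyThree * limDThree a b) hQm (by norm_num) (by norm_num)
    (fun z hz => qMonicThree_root_norm_le hz) sum_coeff_qMonicThree sum_coeff_mul_qMonicThree hK₂ hw
  refine ⟨m₀, m₂, max K₁ K₃, fun n => (hb₁ n).trans ?_, fun n => ?_⟩
  · gcongr; exact le_max_left _ _
  have h := hb₃ n
  rw [hdeg] at h
  set A := limDThree a b with hA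
  have hc : cThree * tOneThree = -tyThree := by rw [cThree]; field_simp
  have e : (-2 * (cThree * A) * tyThree) / tOneThree / 2 * (n : ℝ) ^ 2
      + (((-2 * (cThree * A) * tlyThree - 2 * m₀ * tyThree - tyyThree * A) - (-2 * (cThree * A) * tyThree) / tOneThree * (tTwoThree / 2)) / tOneThree
          - (-2 * (cThree * A) * tyThree) / tOneThree / 2) * (n : ℝ) + m₂
      = cThree ^ 2 * A * (n : ℝ) ^ 2 + linQThree A m₀ * (n : ℝ) + m₂ := by
    have hty : tyThree = -(cThree * tOneThree) := by linarith [hc]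
    rw [linQThree, hty]
    field_simp
  rw [e] at h
  exact h.trans (by gcongr; exact le_max_right _ _)

end W3

end HV

end Literature.Probability.RandomPlanarGeometry.SAW
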